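import Literature.Analysis.Fourier.GradientBoundLpMultiplier
import HarnessLib

/-!
# Localization of a homogeneous Sobolev bound: `χ M ∈ M_p` from the `Ẇ^{1,p}` bound of `M(D)`

`SobolevMultiplierBound.lean` records Rauch's estimate (5) [Rauch1986, Proof of Theorem p. 483]
for the solution operator `M(D)` of a constant-coefficient system as `HasGradientLpBoundWith p c M`
(`Σⱼ ‖M(D)∂ⱼφ‖_p ≤ c Σⱼ ‖∂ⱼφ‖_p`, `φ ∈ C_c^∞`), and the printed route from (5) at `p = 1` and
`p = 2` to `M ∈ M_p`, `1 < p < 2`, passes through "Interpolating, (5) is valid for `Lᵖ`,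
`1 < p < 2`" — the real interpolation of HOMOGENEOUS Sobolev spaces (named fact
`gradientLpBound_interpolation`, [Badr2009]) — and the Riesz transforms (proved:
`isLpMultiplier_of_gradientLpBound_holds`).

This file provides the interpolation-free use of (5): an `Ẇ^{1,p}` bound LOCALIZES. If `χ` is a
smooth compactly supported cut-off in frequency whose support avoids the hyperplane `{ξ_l = 0}`,
then `χM ∈ M_p` with constant `c Σⱼ ‖𝓕⁻¹((ξⱼ/ξ_l)χ)‖_{L¹}`
(`isLpMultiplierWith_smul_of_hasGradientLpBoundWith`): for a Schwartz `f`, the Schwartz function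
`φ = 𝓕⁻¹(χ f̂/(2πiξ_l))` has `∂_lφ = χ(D)f` and `∂ⱼφ = ((ξⱼ/ξ_l)χ)(D)f`, so (5), extended to
Schwartz test functions (`GradientBoundSchwartz.lean`), and Young's inequality
(`isLpMultiplierWith_smul_one_schwartz`, [BrennerThomeeWahlbin1975, Ch. 1 Thm 2.3]) give
`‖(χM)(D)f‖_p = ‖M(D)∂_lφ‖_p ≤ c Σⱼ ‖∂ⱼφ‖_p ≤ c Σⱼ ‖𝓕⁻¹((ξⱼ/ξ_l)χ)‖₁ ‖f‖_p`. Since the `L¹` norm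
of `𝓕⁻¹` is dilation invariant, the same constant serves all dilates `χ(·/n)`, and dilating back
[BrennerThomeeWahlbin1975, Ch. 1 Thm 2.8] one obtains, around every `ξ₁ ≠ 0`, a cut-off `θ = 1`
near `ξ₁` with `θ M((n+1)·) ∈ M_p` UNIFORMLY in `n`
(`exists_localizedFamily_of_hasGradientLpBoundWith`). This is exactly the hypothesis (1.5) that
the proof of [BrennerThomeeWahlbin1975, Ch. 5 §1 Lemma 1.1] consumes (in the tree:
`Literature.Analysis.Fourier.hasLinearEigenvalues_of_localizedFamily`,
`Literature.Analysis.Fourier.false_of_localizedFamily_of_strictlyHyperbolic`,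
`LocalizedPhaseFamilyLinearEigenvalues.lean`), valid for every `1 ≤ p < ∞` including `p = 1`, so
that Rauch's linear step "(5) ⟹ (3)" needs neither the interpolation fact nor the Riesz
transforms nor Brenner's theorem as separate inputs
(`Literature/Barriers/AtomisticToContinuum/NoBVEstimatesMultiDLinearStepL1.lean`).

## References

* [Rauch1986] J. Rauch, Comm. Math. Phys. 106 (1986) 481–484, Proof of Theorem p. 483, (5)–(6).
* [BrennerThomeeWahlbin1975] P. Brenner, V. Thomée, L. B. Wahlbin, LNM 434 (1975), Ch. 1
  Thms 2.3, 2.8; Ch. 5 §1, proof of Lemma 1.1, (1.5).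
* [Badr2009] N. Badr, Math. Scand. 105 (2009) 235–264 (the interpolation input thus avoided).
-/

noncomputable section

open MeasureTheory FourierTransform Filter Topology
open scoped SchwartzMap ENNReal NNReal ContDiff

namespace Literature.Analysis.Fourier

variable {d k k' : ℕ}

/-- Two Schwartz functions with the same Fourier transform are equal (Fourier inversion).
[folklore] -/
theorem schwartz_coe_eq_of_fourier_eq {f g : 𝓢(EuclideanSpace ℝ (Fin d), Fin k → ℂ)}
    (h : 𝓕 (⇑f) = 𝓕 (⇑g)) : (⇑f : EuclideanSpace ℝ (Fin d) → Fin k → ℂ) = ⇑g := by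
  rw [coe_eq_fourierInv_fourier f, coe_eq_fourierInv_fourier g, h]

/-- **`∂ⱼ 𝓕⁻¹(σ f̂) = 𝓕⁻¹(τⱼ f̂)` when `2πiξⱼ σ = τⱼ`**: partial derivatives of a Schwartz
Fourier-multiplier image are again Schwartz Fourier-multiplier images. [folklore] -/
theorem partialDeriv_fourierMultiplierCLM_eq (σ τ : 𝓢(EuclideanSpace ℝ (Fin d), ℂ)) (j : Fin d)
    (hτ : ∀ ξ : EuclideanSpace ℝ (Fin d), (2 * Real.pi * Complex.I * ((ξ j : ℝ) : ℂ)) * σ ξ = τ ξ)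
    (f : 𝓢(EuclideanSpace ℝ (Fin d), Fin k → ℂ)) :
    partialDeriv j ⇑(SchwartzMap.fourierMultiplierCLM (Fin k → ℂ) (⇑σ) f) =
      ⇑(SchwartzMap.fourierMultiplierCLM (Fin k → ℂ) (⇑τ) f) := by
  open LineDeriv in
  have h1 : partialDeriv j ⇑(SchwartzMap.fourierMultiplierCLM (Fin k → ℂ) (⇑σ) f) =
      ⇑(∂_{EuclideanSpace.single j (1 : ℝ)} (SchwartzMap.fourierMultiplierCLM (Fin k → ℂ) (⇑σ) f) :
        𝓢(EuclideanSpace ℝ (Fin d), Fin k → ℂ)) := rfl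
  rw [h1]
  refine schwartz_coe_eq_of_fourier_eq ?_
  rw [← h1]
  funext ξ
  rw [fourier_partialDeriv_schwartz, fourier_coe_fourierMultiplierCLM_schwartz,
    fourier_coe_fourierMultiplierCLM_schwartz]
  simp only [smul_smul, hτ ξ]

/-- **Localization of an `Ẇ^{1,p}` bound.** Let `M` be a bounded, entrywise measurable matrix
symbol on `ℝᵈ` with the `Ẇ^{1,p}` bound `Σⱼ ‖M(D)∂ⱼφ‖_p ≤ c Σⱼ ‖∂ⱼφ‖_p` on `C_c^∞` test functions
(`HasGradientLpBoundWith p c M`), `1 ≤ p < ∞`. Let `χ, σ, τ₁, …, τ_d` be Schwartz scalar symbols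
with `2πiξ_l σ(ξ) = χ(ξ)` for one index `l` and `2πiξⱼ σ(ξ) = τⱼ(ξ)` for all `j` (for `χ`
supported in `{ξ_l ≠ 0}` one takes `σ = χ/(2πiξ_l)`, `τⱼ = (ξⱼ/ξ_l)χ`). Then the localized symbol
`χM` is an `Lᵖ` multiplier with constant `c Σⱼ ‖𝓕⁻¹τⱼ‖_{L¹}`: for a Schwartz `f` the Schwartz
function `φ = 𝓕⁻¹(σ f̂)` has `∂_lφ = χ(D)f` and `∂ⱼφ = τⱼ(D)f`, so
`‖(χM)(D)f‖_p = ‖M(D)∂_lφ‖_p ≤ c Σⱼ ‖∂ⱼφ‖_p ≤ c Σⱼ ‖𝓕⁻¹τⱼ‖₁ ‖f‖_p` by the bound (extended to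
Schwartz test functions, `GradientBoundSchwartz.lean`) and Young's inequality
(`isLpMultiplierWith_smul_one_schwartz`). This is the use the proof of
[BrennerThomeeWahlbin1975, Ch. 5 §1 Lemma 1.1] makes of its hypothesis ((1.5): only the products
`exp(nP̂) · χv` enter), and the form in which Rauch's estimate (5) at `p = 1` feeds it without
interpolation. [cite: Rauch1986, Proof of Theorem p. 483, (5)–(6); BrennerThomeeWahlbin1975,
Ch. 1 Thm 2.3 and Ch. 5 §1 (1.5)] -/
theorem isLpMultiplierWith_smul_of_hasGradientLpBoundWith
    {M : EuclideanSpace ℝ (Fin d) → Matrix (Fin k') (Fin k) ℂ} (hM : ∀ a b, Measurable fun ξ => M ξ a b)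
    {C₀ : ℝ≥0} (hC : ∀ ξ a b, ‖M ξ a b‖ ≤ C₀) {p : ℝ≥0∞} (hp1 : 1 ≤ p) (hp : p ≠ ⊤) {c : ℝ≥0}
    (hW : HasGradientLpBoundWith p c M) (χ σ : 𝓢(EuclideanSpace ℝ (Fin d), ℂ)) (l : Fin d)
    (hσ : ∀ ξ : EuclideanSpace ℝ (Fin d), (2 * Real.pi * Complex.I * ((ξ l : ℝ) : ℂ)) * σ ξ = χ ξ)
    (τ : Fin d → 𝓢(EuclideanSpace ℝ (Fin d), ℂ))
    (hτ : ∀ (j : Fin d) (ξ : EuclideanSpace ℝ (Fin d)),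
      (2 * Real.pi * Complex.I * ((ξ j : ℝ) : ℂ)) * σ ξ = τ j ξ) :
    IsLpMultiplierWith p
      (c * ∑ j, (∫⁻ t, ‖(𝓕⁻ (τ j) : 𝓢(EuclideanSpace ℝ (Fin d), ℂ)) t‖ₑ).toNNReal)
      (fun ξ => χ ξ • M ξ) := by
  classical
  have hC0 : (0 : ℝ) ≤ C₀ := C₀.coe_nonneg
  -- the localized symbol is bounded and measurable
  set B : ℝ := ‖χ.toBoundedContinuousFunction‖ with hB
  have hχB : ∀ ξ, ‖χ ξ‖ ≤ B := fun ξ => χ.toBoundedContinuousFunction.norm_coe_le_norm ξ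
  have hB0 : 0 ≤ B := norm_nonneg _
  have hMχ : ∀ a b, Measurable fun ξ => (χ ξ • M ξ) a b := fun a b => by
    simp only [Matrix.smul_apply, smul_eq_mul]
    exact χ.continuous.measurable.mul (hM a b)
  have hCχ : ∀ ξ a b, ‖(χ ξ • M ξ) a b‖ ≤ B * C₀ := fun ξ a b => by
    rw [Matrix.smul_apply, smul_eq_mul, norm_mul]
    exact mul_le_mul (hχB ξ) (hC ξ a b) (norm_nonneg _) hB0
  refine ⟨fun f => integrable_mulVec_fourier hMχ (mul_nonneg hB0 hC0) hCχ f, fun f => ?_⟩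
  -- the test function `φ = 𝓕⁻¹(σ f̂)` and its derivatives
  set φ : 𝓢(EuclideanSpace ℝ (Fin d), Fin k → ℂ) :=
    SchwartzMap.fourierMultiplierCLM (Fin k → ℂ) (⇑σ) f with hφ
  have hdl : partialDeriv l ⇑φ = ⇑(SchwartzMap.fourierMultiplierCLM (Fin k → ℂ) (⇑χ) f) :=
    partialDeriv_fourierMultiplierCLM_eq σ χ l hσ f
  have hdj : ∀ j, partialDeriv j ⇑φ = ⇑(SchwartzMap.fourierMultiplierCLM (Fin k → ℂ) (⇑(τ j)) f) :=
    fun j => partialDeriv_fourierMultiplierCLM_eq σ (τ j) j (hτ j) f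
  -- `(χM)(D)f = M(D)∂_lφ`
  have hop : multiplierOp (fun ξ => χ ξ • M ξ) ⇑f = multiplierOp M (partialDeriv l ⇑φ) := by
    rw [multiplierOp_apply, multiplierOp_apply, hdl, fourier_coe_fourierMultiplierCLM_schwartz]
    congr 1
    funext ξ
    rw [Matrix.smul_mulVec, Matrix.mulVec_smul]
  rw [hop]
  -- the `Ẇ^{1,p}` bound on the Schwartz function `φ`, then Young for each `τⱼ(D)`
  calc eLpNorm (multiplierOp M (partialDeriv l ⇑φ)) p volume
      ≤ c * ∑ j, eLpNorm (partialDeriv j ⇑φ) p volume :=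
        hW.eLpNorm_multiplierOp_partialDeriv_schwartz_le hM hC hp1 hp φ l
    _ ≤ c * ∑ j, ((∫⁻ t, ‖(𝓕⁻ (τ j) : 𝓢(EuclideanSpace ℝ (Fin d), ℂ)) t‖ₑ).toNNReal : ℝ≥0∞) *
          eLpNorm (⇑f) p volume := by
        gcongr with j _
        rw [hdj j, coe_fourierMultiplierCLM_schwartz_eq_multiplierOp]
        exact (isLpMultiplierWith_smul_one_schwartz (ι := Fin k) (τ j) hp1 hp).bound f
    _ = ((c * ∑ j, (∫⁻ t, ‖(𝓕⁻ (τ j) : 𝓢(EuclideanSpace ℝ (Fin d), ℂ)) t‖ₑ).toNNReal : ℝ≥0) :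
          ℝ≥0∞) * eLpNorm (⇑f) p volume := by
        rw [← Finset.sum_mul, ← mul_assoc]
        push_cast
        rfl

/-! ### Smooth compactly supported quotients -/

/-- If `g` is smooth and `h` is smooth and non-zero on the topological support of `g`, then
`g/h` is smooth (it vanishes near the zeros of `h`). [folklore] -/
theorem contDiff_mul_inv_of_tsupport {E : Type*} [NormedAddCommGroup E] [NormedSpace ℝ E]
    {g h : E → ℝ} (hg : ContDiff ℝ ∞ g) (hh : ContDiff ℝ ∞ h)
    (hsupp : ∀ x ∈ tsupport g, h x ≠ 0) : ContDiff ℝ ∞ fun x => g x * (h x)⁻¹ := by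
  refine contDiff_iff_contDiffAt.2 fun x => ?_
  by_cases hx : h x = 0
  · have hxs : x ∉ tsupport g := fun hmem => hsupp x hmem hx
    have hev : (fun y => g y * (h y)⁻¹) =ᶠ[𝓝 x] fun _ => 0 := by
      filter_upwards [notMem_tsupport_iff_eventuallyEq.1 hxs] with y hy
      rw [hy, Pi.zero_apply, zero_mul]
    exact contDiffAt_const.congr_of_eventuallyEq hev
  · exact hg.contDiffAt.mul (hh.contDiffAt.inv hx)

/-- A coordinate of a difference is bounded by the distance in `ℝᵈ`. [folklore] -/
theorem abs_coord_sub_le_dist (η ξ : EuclideanSpace ℝ (Fin d)) (l : Fin d) :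
    |η l - ξ l| ≤ dist η ξ := by
  have h := PiLp.norm_apply_le (η - ξ) l
  rw [dist_eq_norm]
  simpa [Real.norm_eq_abs] using h

/-! ### Localized families of dilates from an `Ẇ^{1,p}` bound -/

/-- **From an `Ẇ^{1,p}` bound to a localized uniform family of dilates.** Let `M` be a bounded,
entrywise measurable matrix symbol on `ℝᵈ` with `HasGradientLpBoundWith p c M`, `1 ≤ p < ∞`.
Then for every `ξ₁ ≠ 0` there are a real cut-off `θ` with `θ = 1` near `ξ₁` and a constant `C`
such that the localized dilates `θ(ξ)M((n+1)ξ)`, `n = 0, 1, …`, are `Lᵖ` multipliers with the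
ONE constant `C`. Construction: `ξ₁` has a coordinate `(ξ₁)_l ≠ 0`; take a bump `θ` around `ξ₁`
of radius `|(ξ₁)_l|/2` (so `ξ_l ≠ 0` on its support), `ψ = θ/ξ_l`, `ρⱼ = ξⱼψ` (smooth, compactly
supported, `ρ_l = θ`); for each `n` the Schwartz symbols `σₙ(η) = ψ(η/(n+1))/(2πi(n+1))`,
`τₙⱼ(η) = ρⱼ(η/(n+1))` satisfy `2πiηⱼσₙ = τₙⱼ`, `τₙ_l(η) = θ(η/(n+1))`, so
`isLpMultiplierWith_smul_of_hasGradientLpBoundWith` puts `θ(·/(n+1))M` in `M_p` with constant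
`c Σⱼ ‖𝓕⁻¹τₙⱼ‖₁ = c Σⱼ ‖𝓕⁻¹ρⱼ‖₁` (dilation invariance of `‖𝓕⁻¹·‖₁`,
`lintegral_enorm_fourierInv_comp_smul`), and dilating back by `n+1`
[BrennerThomeeWahlbin1975, Ch. 1 Thm 2.8] (`IsLpMultiplierWith.comp_smul`) gives
`θ M((n+1)·) ∈ M_p` with the same constant. This is (1.5) of the proof of
[BrennerThomeeWahlbin1975, Ch. 5 §1 Lemma 1.1] fed by an `Ẇ^{1,p}` bound instead of
`exp(P̂) ∈ M_p` — at `p = 1`, by Rauch's (5) without interpolation.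
[cite: BrennerThomeeWahlbin1975, Ch. 1 Thm 2.8 and Ch. 5 §1 (1.5); Rauch1986, Proof of Theorem
p. 483, (5)] -/
theorem exists_localizedFamily_of_hasGradientLpBoundWith
    {M : EuclideanSpace ℝ (Fin d) → Matrix (Fin k') (Fin k) ℂ} (hM : ∀ a b, Measurable fun ξ => M ξ a b)
    {C₀ : ℝ≥0} (hC : ∀ ξ a b, ‖M ξ a b‖ ≤ C₀) {p : ℝ≥0∞} (hp1 : 1 ≤ p) (hp : p ≠ ⊤) {c : ℝ≥0}
    (hW : HasGradientLpBoundWith p c M) {ξ₁ : EuclideanSpace ℝ (Fin d)} (hξ₁ : ξ₁ ≠ 0) :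
    ∃ (θ : EuclideanSpace ℝ (Fin d) → ℝ) (C : ℝ≥0), (∀ᶠ ξ in 𝓝 ξ₁, θ ξ = 1) ∧
      ∀ n : ℕ, IsLpMultiplierWith p C (fun ξ => ((θ ξ : ℝ) : ℂ) • M ((((n : ℝ) + 1) : ℝ) • ξ)) := by
  classical
  -- a non-zero coordinate of `ξ₁`
  obtain ⟨l, hl⟩ : ∃ l, ξ₁ l ≠ 0 := by
    by_contra h
    push Not at h
    exact hξ₁ (PiLp.ext fun i => by simpa using h i)
  -- the bump `θ` of radius `r = |ξ₁ l|/2` around `ξ₁`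
  set r : ℝ := |ξ₁ l| / 2 with hr
  have hr0 : 0 < r := half_pos (abs_pos.2 hl)
  set θb : ContDiffBump ξ₁ := ⟨r / 2, r, half_pos hr0, half_lt_self hr0⟩ with hθb
  have hθsupp : ∀ η ∈ tsupport (θb : EuclideanSpace ℝ (Fin d) → ℝ), η l ≠ 0 := by
    intro η hη h0
    rw [θb.tsupport_eq, Metric.mem_closedBall] at hη
    have h1 := abs_coord_sub_le_dist η ξ₁ l
    rw [h0, zero_sub, abs_neg] at h1
    have : |ξ₁ l| ≤ r := h1.trans hη
    rw [hr] at this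
    linarith [abs_pos.2 hl]
  have hθzero : ∀ η : EuclideanSpace ℝ (Fin d), η l = 0 → θb η = 0 := fun η hη =>
    image_eq_zero_of_notMem_tsupport fun hmem => hθsupp η hmem hη
  -- `ψ = θ/ξ_l` and `ρⱼ = ξⱼψ`
  set ψ : EuclideanSpace ℝ (Fin d) → ℝ := fun η => θb η * (η l)⁻¹ with hψ
  have hψs : ContDiff ℝ ∞ ψ := contDiff_mul_inv_of_tsupport θb.contDiff (contDiff_coord l) hθsupp
  have hψc : HasCompactSupport ψ := θb.hasCompactSupport.mul_right
  set ρ : Fin d → EuclideanSpace ℝ (Fin d) → ℝ := fun j η => η j * ψ η with hρ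
  have hρs : ∀ j, ContDiff ℝ ∞ (ρ j) := fun j => (contDiff_coord j).mul hψs
  have hρc : ∀ j, HasCompactSupport (ρ j) := fun j => hψc.mul_left
  have hρl : ∀ η, ρ l η = θb η := by
    intro η
    by_cases hη : η l = 0
    · rw [hρ]; dsimp only; rw [hθzero η hη, hψ]; simp [hη]
    · rw [hρ, hψ]; dsimp only; field_simp
  -- the complexified `ρⱼ` and the constant
  set ρc : Fin d → EuclideanSpace ℝ (Fin d) → ℂ := fun j η => ((ρ j η : ℝ) : ℂ) with hρcdef
  set C : ℝ≥0 := c * ∑ j, (∫⁻ t, ‖𝓕⁻ (ρc j) t‖ₑ).toNNReal with hCdef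
  refine ⟨θb, C, θb.eventuallyEq_one, fun n => ?_⟩
  -- the dilation parameter
  set a : ℝ := ((n : ℝ) + 1)⁻¹ with ha
  have ha0 : 0 < a := by rw [ha]; positivity
  have hn0 : (0 : ℝ) < (n : ℝ) + 1 := by positivity
  -- the Schwartz symbols `τₙⱼ(η) = ρⱼ(aη)` and `σₙ(η) = ψ(aη)/(2πi(n+1))`
  have hTs : ∀ j, ContDiff ℝ ∞ fun η : EuclideanSpace ℝ (Fin d) => ((ρ j (a • η) : ℝ) : ℂ) :=
    fun j => Complex.ofRealCLM.contDiff.comp ((hρs j).comp (contDiff_const_smul a))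
  have hTc : ∀ j, HasCompactSupport fun η : EuclideanSpace ℝ (Fin d) => ((ρ j (a • η) : ℝ) : ℂ) :=
    fun j => ((hρc j).comp_homeomorph (Homeomorph.smulOfNeZero a ha0.ne')).comp_left
      Complex.ofReal_zero
  set T : Fin d → 𝓢(EuclideanSpace ℝ (Fin d), ℂ) := fun j => (hTc j).toSchwartzMap (hTs j) with hT
  have hTapply : ∀ j η, T j η = ((ρ j (a • η) : ℝ) : ℂ) := fun j η => rfl
  have hSs : ContDiff ℝ ∞ fun η : EuclideanSpace ℝ (Fin d) => ((ψ (a • η) : ℝ) : ℂ) :=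
    Complex.ofRealCLM.contDiff.comp (hψs.comp (contDiff_const_smul a))
  have hSc : HasCompactSupport fun η : EuclideanSpace ℝ (Fin d) => ((ψ (a • η) : ℝ) : ℂ) :=
    (hψc.comp_homeomorph (Homeomorph.smulOfNeZero a ha0.ne')).comp_left Complex.ofReal_zero
  set S : 𝓢(EuclideanSpace ℝ (Fin d), ℂ) :=
    (2 * Real.pi * Complex.I * (((n : ℝ) + 1 : ℝ) : ℂ))⁻¹ • hSc.toSchwartzMap hSs with hS
  have hSapply : ∀ η, S η = (2 * Real.pi * Complex.I * (((n : ℝ) + 1 : ℝ) : ℂ))⁻¹ *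
      ((ψ (a • η) : ℝ) : ℂ) := fun η => rfl
  -- the relations `2πiηⱼ σₙ = τₙⱼ`
  have hτ : ∀ (j : Fin d) (η : EuclideanSpace ℝ (Fin d)),
      (2 * Real.pi * Complex.I * ((η j : ℝ) : ℂ)) * S η = T j η := by
    intro j η
    rw [hSapply, hTapply, hρ]
    dsimp only
    rw [PiLp.smul_apply, smul_eq_mul, ha]
    have hπ : (Real.pi : ℂ) ≠ 0 := by exact_mod_cast Real.pi_ne_zero
    have hn1 : (((n : ℝ) + 1 : ℝ) : ℂ) ≠ 0 := by exact_mod_cast hn0.ne'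
    push_cast
    field_simp
  -- localization at scale `n`
  have hloc := isLpMultiplierWith_smul_of_hasGradientLpBoundWith hM hC hp1 hp hW (T l) S l (hτ l) T hτ
  -- the constant does not depend on `n`
  have hconst : (c * ∑ j, (∫⁻ t, ‖(𝓕⁻ (T j) : 𝓢(EuclideanSpace ℝ (Fin d), ℂ)) t‖ₑ).toNNReal) = C := by
    rw [hCdef]
    congr 1
    refine Finset.sum_congr rfl fun j _ => ?_
    congr 1
    rw [SchwartzMap.fourierInv_coe]
    have hcoe : (⇑(T j) : EuclideanSpace ℝ (Fin d) → ℂ) = fun η => ρc j (a • η) :=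
      funext fun η => hTapply j η
    rw [hcoe]
    exact lintegral_enorm_fourierInv_comp_smul (ρc j) ha0
  rw [hconst] at hloc
  -- dilate back by `n + 1`
  have hdil := hloc.comp_smul (c := (n : ℝ) + 1) hn0.ne'
  have heq : (fun ξ : EuclideanSpace ℝ (Fin d) => T l (((n : ℝ) + 1) • ξ) • M (((n : ℝ) + 1) • ξ)) =
      fun ξ => ((θb ξ : ℝ) : ℂ) • M ((((n : ℝ) + 1) : ℝ) • ξ) := by
    funext ξ
    rw [hTapply, smul_smul, ha, inv_mul_cancel₀ hn0.ne', one_smul, hρl]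
  rwa [heq] at hdil

end Literature.Analysis.Fourier

end
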